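import Mathlib.NumberTheory.NumberField.Completion.FinitePlace
import Mathlib.NumberTheory.NumberField.Completion.InfinitePlace
import Mathlib.FieldTheory.IsAlgClosed.AlgebraicClosure
import Mathlib.FieldTheory.AbsoluteGaloisGroup
import Mathlib.FieldTheory.Normal.Defs
import Mathlib.FieldTheory.Galois.Profinite
import Mathlib.FieldTheory.KrullTopology
import Mathlib.Topology.Algebra.ContinuousMonoidHom
import Mathlib.RepresentationTheory.Homological.ContCohomology.Functoriality
import Literature.NumberTheory.EllipticCurves.GaloisAction
import HarnessLib

-- provenance: harness21/H21/H21/Prelude/TranscendEllArithS/Sha.lean @ cfecf1d (interim HEAD d8f2665); M5 mechanical rewrite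
/-!
# The Tate–Shafarevich group of a Weierstrass curve over a number field

Trunk T-ELLARITH (group G06, outline item C19 `Sha`); notion `sha_group`.

For a Weierstrass curve `W` (an elliptic curve `E`) over a number field `K`, the Tate–Shafarevich
group is
`Ш(E/K) = ker ( H¹(K, E) → ∏_v H¹(K_v, E) )`,
the product running over *all* places `v` of `K` (finite places `v : HeightOneSpectrum (𝓞 K)`, with
`K_v = v.adicCompletion K`, and infinite places `w : NumberField.InfinitePlace K`, with
`K_w = w.Completion`). Here `H¹(K, E) = H¹_cont(Γ_K, E(K̄))` is Mathlib's continuous group cohomology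
`continuousCohomology 1` of the discrete `Γ_K`-module `E(K̄) = geomPoints W` (file `GaloisAction`), and
the local restriction `H¹(K, E) → H¹(K_v, E)` is `ContinuousCohomology.map` along the compatible pair
`(Γ_{K_v} → Γ_K, E(K̄) → E(K̄_v))` determined by a `K`-embedding `K̄ ↪ K̄_v` of algebraic closures.

Sources: Tate (1974), *The arithmetic of elliptic curves*, §1; Silverman, *AEC*, X.§4 (Def. of `Ш`,
Thm. X.4.2); Milne, *Arithmetic Duality Theorems*, I.§6; Serre, *Galois Cohomology*, II.§1 and I.§2.4.

## Mathlib reuse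

Everything topological/cohomological is Mathlib's: `Field.absoluteGaloisGroup` with its Krull topology,
`AlgebraicClosure`, `IsAlgClosed.lift`, `AlgEquiv.restrictScalars`, `AlgEquiv.restrictNormalHom`,
`AlgEquiv.restrictNormal_commutes`, `IsAlgClosure.normal`, `ContinuousMonoidHom`,
`continuousCohomology`, `ContinuousCohomology.map`, `HeightOneSpectrum.adicCompletion`,
`NumberField.InfinitePlace.Completion`, `AddSubgroup.torsionBy`, `Nat.card`. Mathlib has no
Tate–Shafarevich group, Selmer group or local/global Galois cohomology of elliptic curves (grep:
`Shafarevich`, `Selmer` only for the Selmer group of a *number field* in `Mathlib.NumberTheory`).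

## Design choices

* Group-wide rules: `noncomputable section`, `open scoped Classical`, no `[DecidableEq]` variables; one
  named universe `u` with `K E : Type u` (forced by `ContinuousCohomology.map`, cf. `GaloisAction`).
* Local data are indexed by an arbitrary field `E` with `[Algebra K E]` (instantiated at
  `v.adicCompletion K` and at `w.Completion`); there is no sum type of places. `Ш` is the intersection
  of the kernels over the two index types.
* All constructions are first made for an arbitrary `K`-embedding `ι : K̄ →ₐ[K] K̄_E`
  (names `…OfEmb`), then specialised to the chosen embedding `closureEmb E := IsAlgClosed.lift`;
  `WeierstrassCurve.localRestrictionKerOfEmb_eq` and `WeierstrassCurve.sha_eq_of_algHom` record the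
  independence of the choice; the former is discharged (`localRestrictionKerOfEmb_eq_holds`, end of
  file) via "inner automorphisms act trivially on `H¹`" (`Literature.NumberTheory.EllipticCurves.map_conj_one_eq_id`), proved directly in
  Mathlib's homogeneous continuous cochains.
* The restriction `Γ_E → Γ_K` is `AlgEquiv.restrictNormalHom` for the tower `K ≤ K̄ ≤ K̄_E` given by
  `ι` (all instances genuinely provided inside the term). Its continuity `continuous_resGalAuxOfEmb` is
  fully proved here (Krull topology on both sides), so `resGal E : Γ_E →ₜ* Γ_K` carries no `sorry`.
* `localPoints W E = E(K̄_E)` is a `def` (type synonym) carrying the discrete topology and the action of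
  `Γ_E` obtained from the generic `GaloisAction` instance for `K̄_E ≃ₐ[K] K̄_E` through
  `restrictScalarsHom : Γ_E →* (K̄_E ≃ₐ[K] K̄_E)`.
* `shaOrder W := Nat.card W.sha` takes the junk value `0` when `Ш` is infinite (documented);
  `ShaFinite W := Finite W.sha` is the finiteness **predicate** — the hypothesis `(h : W.ShaFinite)`
  of its users, never asserted here. Its universal closure over elliptic curves is the OPEN
  Tate–Shafarevich conjecture (Silverman, *AEC*, Conj. X.4.13; registered as the closed `Prop`s
  `Literature.NumberTheory.EllipticCurves.ShaFiniteConjecture[NF]` in `BSDSha`), so `ShaFinite` is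
  a registered OPEN statement (docstring `OPEN CONJECTURE — … [status: open]`, CONVENTIONS §4),
  not literature debt: no `ShaFinite_holds` can exist. Verdict clean-up 2026-08-15: name and body
  kept (the predicate has users throughout the BSD files); the def now carries its own header
  binders `(W : WeierstrassCurve K) [NumberField K]` (declared between two `section NumberField`
  blocks, so that no section instance is duplicated), leaving the elaborated type
  `∀ {K} [Field K] (W : WeierstrassCurve K) [NumberField K], Prop` unchanged, and the census reads
  a parametrised predicate.
* `resGalAux_injective` is stated only for completions of `K` (for a general `K`-field `E` the map
  `Γ_E → Γ_K` need not be injective).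
* Declarations about Weierstrass curves' cohomology (`galH1`, `localH1`, `localRestriction…`, `sha`, …)
  are deliberate dot-notation extensions in `namespace WeierstrassCurve`; the embedding/Galois glue lives
  in `namespace Literature`.
-/

noncomputable section

open scoped Classical

open NumberField IsDedekindDomain

universe u

namespace Literature.NumberTheory.EllipticCurves

variable {K : Type u} [Field K]

/-! ## Embeddings of algebraic closures and restriction of Galois groups -/

section Emb

variable (E : Type u) [Field E] [Algebra K E]

/-- The chosen `K`-embedding `K̄ →ₐ[K] K̄_E` of the algebraic closure of `K` into the algebraic closure
of a field extension `E` of `K` (Mathlib's `IsAlgClosed.lift`; `K̄_E` is a `K`-algebra via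
`AlgebraicClosure.instAlgebra`). Any two such embeddings differ by an element of `Γ_K`.
Serre, *Galois Cohomology*, II.§1; Silverman, *AEC*, X.§4 (choice of decomposition groups). [folklore] -/
def closureEmb : AlgebraicClosure K →ₐ[K] AlgebraicClosure E :=
  IsAlgClosed.lift

/-- Restriction of scalars `Γ_E = Aut(K̄_E/E) → Aut_K(K̄_E)` as a monoid homomorphism
(`AlgEquiv.restrictScalars K`). Serre, *Galois Cohomology*, II.§1. [folklore] -/
def restrictScalarsHom :
    Field.absoluteGaloisGroup E →* (AlgebraicClosure E ≃ₐ[K] AlgebraicClosure E) where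
  toFun σ := AlgEquiv.restrictScalars K σ
  map_one' := rfl
  map_mul' _ _ := rfl

/-- Unfolding `restrictScalarsHom`. Serre, *Galois Cohomology*, II.§1. [folklore] -/
@[simp]
theorem restrictScalarsHom_apply (σ : Field.absoluteGaloisGroup E) :
    restrictScalarsHom (K := K) E σ =
      AlgEquiv.restrictScalars K (show AlgebraicClosure E ≃ₐ[E] AlgebraicClosure E from σ) :=
  rfl

variable {E}
variable (ι : AlgebraicClosure K →ₐ[K] AlgebraicClosure E)

/-- The restriction homomorphism `Γ_E → Γ_K`, `σ ↦ ι⁻¹ ∘ σ|_{ι(K̄)} ∘ ι`, attached to a `K`-embedding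
`ι : K̄ → K̄_E`: Mathlib's `AlgEquiv.restrictNormalHom` for the tower `K ≤ K̄ ≤ K̄_E` defined by `ι`
(`K̄/K` is normal: `IsAlgClosure.normal`), precomposed with `restrictScalarsHom`.
Serre, *Galois Cohomology*, II.§1.1; Silverman, *AEC*, X.§4 (`G_v ⊂ G_K`). [folklore] -/
def resGalAuxOfEmb : Field.absoluteGaloisGroup E →* Field.absoluteGaloisGroup K :=
  letI : Algebra (AlgebraicClosure K) (AlgebraicClosure E) := ι.toRingHom.toAlgebra
  haveI : IsScalarTower K (AlgebraicClosure K) (AlgebraicClosure E) :=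
    IsScalarTower.of_algebraMap_eq fun x ↦ (ι.commutes x).symm
  (AlgEquiv.restrictNormalHom (F := K) (K₁ := AlgebraicClosure E) (AlgebraicClosure K)).comp
    (restrictScalarsHom (K := K) E)

/-- The defining property of `resGalAuxOfEmb ι`: `ι ∘ (resGalAuxOfEmb ι σ) = σ ∘ ι` as `K`-algebra maps
`K̄ → K̄_E` (`AlgEquiv.restrictNormal_commutes`). Serre, *Galois Cohomology*, II.§1.1. [folklore] -/
theorem comp_resGalAuxOfEmb (σ : Field.absoluteGaloisGroup E) :
    ι.comp ((show AlgebraicClosure K ≃ₐ[K] AlgebraicClosure K from resGalAuxOfEmb ι σ) :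
        AlgebraicClosure K →ₐ[K] AlgebraicClosure K) =
      ((AlgEquiv.restrictScalars K
          (show AlgebraicClosure E ≃ₐ[E] AlgebraicClosure E from σ) :
            AlgebraicClosure E ≃ₐ[K] AlgebraicClosure E) :
          AlgebraicClosure E →ₐ[K] AlgebraicClosure E).comp ι := by
  letI : Algebra (AlgebraicClosure K) (AlgebraicClosure E) := ι.toRingHom.toAlgebra
  haveI : IsScalarTower K (AlgebraicClosure K) (AlgebraicClosure E) :=
    IsScalarTower.of_algebraMap_eq fun x ↦ (ι.commutes x).symm
  ext x
  exact AlgEquiv.restrictNormal_commutes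
    (AlgEquiv.restrictScalars K (show AlgebraicClosure E ≃ₐ[E] AlgebraicClosure E from σ))
    (AlgebraicClosure K) x

/-- Pointwise form of `comp_resGalAuxOfEmb`: `ι (resGalAuxOfEmb ι σ x) = σ (ι x)`.
Serre, *Galois Cohomology*, II.§1.1. [folklore] -/
theorem apply_resGalAuxOfEmb_apply (σ : Field.absoluteGaloisGroup E) (x : AlgebraicClosure K) :
    ι ((show AlgebraicClosure K ≃ₐ[K] AlgebraicClosure K from resGalAuxOfEmb ι σ) x) =
      (show AlgebraicClosure E ≃ₐ[E] AlgebraicClosure E from σ) (ι x) :=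
  congrArg (fun f : AlgebraicClosure K →ₐ[K] AlgebraicClosure E => f x) (comp_resGalAuxOfEmb ι σ)

/-- The restriction `Γ_E → Γ_K` attached to `ι` is continuous for the Krull topologies: the preimage
of `Gal(K̄/F)` for `F/K` finite contains `Gal(K̄_E/E(ι b₁, …, ι bₙ))` for a `K`-basis `bᵢ` of `F`.
Serre, *Galois Cohomology*, II.§1.1; cf. Mathlib `InfiniteGalois.restrictNormalHom_continuous`. [folklore] -/
theorem continuous_resGalAuxOfEmb : Continuous (resGalAuxOfEmb ι) := by
  apply continuous_of_continuousAt_one _ (continuousAt_def.mpr _)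
  intro N hN
  rw [map_one] at hN
  obtain ⟨L', hfd, hO⟩ := (krullTopology_mem_nhds_one_iff K (AlgebraicClosure K) N).mp hN
  refine (krullTopology_mem_nhds_one_iff E (AlgebraicClosure E) _).mpr ?_
  let b := Module.finBasis K L'
  let S : Set (AlgebraicClosure E) := Set.range fun i => ι (b i)
  refine ⟨IntermediateField.adjoin E S, ?_, ?_⟩
  · exact IntermediateField.finiteDimensional_adjoin fun x _ => Algebra.IsIntegral.isIntegral x
  · intro σ hσ
    apply hO
    simp only [SetLike.mem_coe, IntermediateField.mem_fixingSubgroup_iff] at hσ ⊢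
    intro y hy
    apply ι.toRingHom.injective
    change ι _ = ι _
    rw [apply_resGalAuxOfEmb_apply]
    have key : ∀ i, σ (ι (b i)) = ι (b i) := fun i =>
      hσ _ (IntermediateField.subset_adjoin E S ⟨i, rfl⟩)
    have := b.ext
      (f₁ := (AlgEquiv.restrictScalars K σ).toLinearMap ∘ₗ ι.toLinearMap ∘ₗ L'.val.toLinearMap)
      (f₂ := ι.toLinearMap ∘ₗ L'.val.toLinearMap) (fun i => by simpa using key i)
    exact congr($this ⟨y, hy⟩)

/-- The restriction `Γ_E → Γ_K` attached to `ι` as a continuous monoid homomorphism.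
Relies on: continuous_resGalAuxOfEmb (proved).
Serre, *Galois Cohomology*, II.§1.1. [folklore] -/
def resGalOfEmb : Field.absoluteGaloisGroup E →ₜ* Field.absoluteGaloisGroup K where
  toMonoidHom := resGalAuxOfEmb ι
  continuous_toFun := continuous_resGalAuxOfEmb ι

/-- Unfolding `resGalOfEmb`. Serre, *Galois Cohomology*, II.§1.1. [folklore] -/
@[simp]
theorem resGalOfEmb_apply (σ : Field.absoluteGaloisGroup E) :
    resGalOfEmb ι σ = resGalAuxOfEmb ι σ :=
  rfl

variable (E)

/-- The restriction `Γ_E → Γ_K` for the chosen embedding `closureEmb E`.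
Serre, *Galois Cohomology*, II.§1.1; Silverman, *AEC*, X.§4. [folklore] -/
def resGalAux : Field.absoluteGaloisGroup E →* Field.absoluteGaloisGroup K :=
  resGalAuxOfEmb (closureEmb (K := K) E)

/-- Continuity of `resGalAux E` (Krull topologies). Serre, *Galois Cohomology*, II.§1.1. [folklore] -/
theorem continuous_resGalAux : Continuous (resGalAux (K := K) E) :=
  continuous_resGalAuxOfEmb _

/-- The restriction `Γ_E → Γ_K` for the chosen embedding, as a continuous monoid homomorphism.
Relies on: continuous_resGalAux (proved).
Serre, *Galois Cohomology*, II.§1.1; Silverman, *AEC*, X.§4. [folklore] -/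
def resGal : Field.absoluteGaloisGroup E →ₜ* Field.absoluteGaloisGroup K where
  toMonoidHom := resGalAux (K := K) E
  continuous_toFun := continuous_resGalAux (K := K) E

/-- `resGal E` is `resGalOfEmb (closureEmb E)` (definitionally). Serre, *Galois Cohomology*, II.§1.1. [folklore] -/
theorem resGal_eq : resGal (K := K) E = resGalOfEmb (closureEmb (K := K) E) :=
  rfl

/-- `closureEmb ∘ resGalAux σ = σ ∘ closureEmb`. Serre, *Galois Cohomology*, II.§1.1. [folklore] -/
theorem closureEmb_comp_resGalAux (σ : Field.absoluteGaloisGroup E) :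
    (closureEmb (K := K) E).comp
        ((show AlgebraicClosure K ≃ₐ[K] AlgebraicClosure K from resGalAux (K := K) E σ) :
          AlgebraicClosure K →ₐ[K] AlgebraicClosure K) =
      ((AlgEquiv.restrictScalars K
          (show AlgebraicClosure E ≃ₐ[E] AlgebraicClosure E from σ) :
            AlgebraicClosure E ≃ₐ[K] AlgebraicClosure E) :
          AlgebraicClosure E →ₐ[K] AlgebraicClosure E).comp (closureEmb (K := K) E) :=
  comp_resGalAuxOfEmb _ σ

end Emb

/-! ## Local points `E(K̄_E)` as a discrete `Γ_E`-module -/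

section Points

variable (W : WeierstrassCurve K) (E : Type u) [Field E] [Algebra K E]

/-- The local coefficient module `E(K̄_E)`: the (type synonym for the) group of points of `W` over the
algebraic closure of the `K`-field `E` (typically a completion `K_v`). A `def`, so that the discrete
topology stays local. Silverman, *AEC*, X.§4; Serre, *Galois Cohomology*, II.§1. [folklore] -/
def localPoints : Type u :=
  (W.baseChange (AlgebraicClosure E)).toAffine.Point

/-- `E(K̄_E)` is an abelian group (Mathlib's group law). Silverman, *AEC*, III.§2. [folklore] -/
instance localPoints.instAddCommGroup : AddCommGroup (localPoints W E) :=
  inferInstanceAs (AddCommGroup (W.baseChange (AlgebraicClosure E)).toAffine.Point)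

/-- `E(K̄_E)` carries the discrete topology. Serre, *Galois Cohomology*, II.§1. [folklore] -/
instance localPoints.instTopologicalSpace : TopologicalSpace (localPoints W E) := ⊥

/-- The topology on `E(K̄_E)` is discrete by definition. Serre, *Galois Cohomology*, II.§1. [folklore] -/
instance localPoints.instDiscreteTopology : DiscreteTopology (localPoints W E) := ⟨rfl⟩

/-- `Γ_E = Gal(K̄_E/E)` acts on `E(K̄_E)` through `restrictScalarsHom : Γ_E → Aut_K(K̄_E)` and the
coordinatewise action of the latter (`WeierstrassCurve.instDistribMulActionAlgEquivPoint`).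
Silverman, *AEC*, VIII.§1 and X.§4. [folklore] -/
instance localPoints.instDistribMulActionAbsoluteGaloisGroup :
    DistribMulAction (Field.absoluteGaloisGroup E) (localPoints W E) :=
  letI : DistribMulAction (AlgebraicClosure E ≃ₐ[K] AlgebraicClosure E) (localPoints W E) :=
    inferInstanceAs (DistribMulAction (AlgebraicClosure E ≃ₐ[K] AlgebraicClosure E)
      (W.baseChange (AlgebraicClosure E)).toAffine.Point)
  DistribMulAction.compHom _ (restrictScalarsHom (K := K) E)

/-- Unfolding the `Γ_E`-action on `E(K̄_E)`: `σ • P = Point.map ↑(σ.restrictScalars K) P`.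
Silverman, *AEC*, VIII.§1. [folklore] -/
theorem localPoints.smul_def (σ : Field.absoluteGaloisGroup E) (P : localPoints W E) :
    σ • P = WeierstrassCurve.Affine.Point.map
      ((AlgEquiv.restrictScalars K (show AlgebraicClosure E ≃ₐ[E] AlgebraicClosure E from σ) :
          AlgebraicClosure E ≃ₐ[K] AlgebraicClosure E) :
        AlgebraicClosure E →ₐ[K] AlgebraicClosure E)
      (show (W.baseChange (AlgebraicClosure E)).toAffine.Point from P) :=
  rfl

variable {E}
variable (ι : AlgebraicClosure K →ₐ[K] AlgebraicClosure E)

/-- The map on points `E(K̄) → E(K̄_E)` induced by a `K`-embedding `ι : K̄ → K̄_E`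
(`Affine.Point.map ι`, an injective group homomorphism). Silverman, *AEC*, X.§4. [folklore] -/
def pointsMapOfEmb : WeierstrassCurve.geomPoints W →+ localPoints W E :=
  WeierstrassCurve.Affine.Point.map ι

/-- `pointsMapOfEmb ι` is injective (`ι` is). Silverman, *AEC*, X.§4. [folklore] -/
theorem pointsMapOfEmb_injective : Function.Injective (pointsMapOfEmb W ι) :=
  WeierstrassCurve.Affine.Point.map_injective (W' := W) ι

/-- Equivariance of `pointsMapOfEmb ι` along `resGalOfEmb ι`: `ι_* (σ|_K̄ • P) = σ • ι_* P`, i.e.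
`(resGalOfEmb ι, pointsMapOfEmb ι)` is a compatible pair. Serre, *Galois Cohomology*, I.§2.4 and
II.§1.1. [folklore] -/
theorem pointsMapOfEmb_smul (σ : Field.absoluteGaloisGroup E) (P : WeierstrassCurve.geomPoints W) :
    pointsMapOfEmb W ι (resGalOfEmb ι σ • P) = σ • pointsMapOfEmb W ι P := by
  change WeierstrassCurve.Affine.Point.map _ (WeierstrassCurve.Affine.Point.map _ P) =
    WeierstrassCurve.Affine.Point.map _ (WeierstrassCurve.Affine.Point.map _ P)
  rw [WeierstrassCurve.Affine.Point.map_map, WeierstrassCurve.Affine.Point.map_map]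
  exact congrArg (fun f => WeierstrassCurve.Affine.Point.map f P) (comp_resGalAuxOfEmb ι σ)

variable (E)

/-- The map on points `E(K̄) → E(K̄_E)` for the chosen embedding `closureEmb E`.
Silverman, *AEC*, X.§4. [folklore] -/
def pointsMap : WeierstrassCurve.geomPoints W →+ localPoints W E :=
  pointsMapOfEmb W (closureEmb (K := K) E)

/-- Equivariance of `pointsMap` along `resGal`: `pointsMap (resGal σ • P) = σ • pointsMap P`.
Serre, *Galois Cohomology*, I.§2.4 and II.§1.1. [folklore] -/
theorem pointsMap_smul (σ : Field.absoluteGaloisGroup E) (P : WeierstrassCurve.geomPoints W) :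
    pointsMap W E (resGal (K := K) E σ • P) = σ • pointsMap W E P :=
  pointsMapOfEmb_smul W _ σ P

end Points

end Literature.NumberTheory.EllipticCurves

/-! ## `H¹(K, E)`, local restrictions and `Ш` -/

namespace WeierstrassCurve

open Literature.NumberTheory.EllipticCurves

variable {K : Type u} [Field K] (W : WeierstrassCurve K)

/-- The Galois cohomology group `H¹(K, E) = H¹_cont(Γ_K, E(K̄))` of `W` (Mathlib's
`continuousCohomology 1` of the discrete `Γ_K`-module `geomPoints W`, as a type; an `AddCommGroup`).
It classifies torsors (principal homogeneous spaces) under `E`: the Weil–Châtelet group.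
Silverman, *AEC*, X.§3–4; Serre, *Galois Cohomology*, I.§2.2, II.§1. [folklore] -/
abbrev galH1 : Type u :=
  discreteH1 (Field.absoluteGaloisGroup K) (geomPoints W)

variable (E : Type u) [Field E] [Algebra K E]

/-- The local cohomology group `H¹(E, E(K̄_E)) = H¹_cont(Γ_E, localPoints W E)` at a `K`-field `E`
(a completion `K_v`). Silverman, *AEC*, X.§4; Milne, *ADT*, I.§6. [folklore] -/
abbrev localH1 : Type u :=
  discreteH1 (Field.absoluteGaloisGroup E) (localPoints W E)

variable {E}
variable (ι : AlgebraicClosure K →ₐ[K] AlgebraicClosure E)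

/-- The local restriction map `H¹(K, E) ⟶ H¹(E, E)` attached to a `K`-embedding `ι : K̄ → K̄_E`
(Mathlib's `ContinuousCohomology.map` along the compatible pair `(resGalOfEmb ι, pointsMapOfEmb ι)`;
a morphism in `TopModuleCat ℤ`). Silverman, *AEC*, X.§4; Serre, *Galois Cohomology*, I.§2.4. [folklore] -/
def localRestrictionOfEmb :
    continuousCohomology 1 (discreteTopRep (Field.absoluteGaloisGroup K) (geomPoints W)) ⟶
      continuousCohomology 1 (discreteTopRep (Field.absoluteGaloisGroup E) (localPoints W E)) :=
  ContinuousCohomology.map (resGalOfEmb ι)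
    (resHomOfEquivariant (resGalOfEmb ι) (pointsMapOfEmb W ι) (pointsMapOfEmb_smul W ι)) 1

/-- The kernel of the local restriction `H¹(K, E) → H¹(E, E)` attached to `ι` (`Literature.NumberTheory.EllipticCurves.resKer`).
Silverman, *AEC*, X.§4. [folklore] -/
def localRestrictionKerOfEmb : AddSubgroup W.galH1 :=
  resKer (resGalOfEmb ι) (pointsMapOfEmb W ι) (pointsMapOfEmb_smul W ι)

variable (E)

/-- The local restriction map `H¹(K, E) ⟶ H¹(E, E)` for the chosen embedding `closureEmb E`
(a morphism in `TopModuleCat ℤ`). Silverman, *AEC*, X.§4; Milne, *ADT*, I.§6. [folklore] -/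
def localRestriction :
    continuousCohomology 1 (discreteTopRep (Field.absoluteGaloisGroup K) (geomPoints W)) ⟶
      continuousCohomology 1 (discreteTopRep (Field.absoluteGaloisGroup E) (localPoints W E)) :=
  ContinuousCohomology.map (resGal (K := K) E)
    (resHomOfEquivariant (resGal (K := K) E) (pointsMap W E) (pointsMap_smul W E)) 1

/-- `localRestriction W E` is `localRestrictionOfEmb W (closureEmb E)` (definitional).
Silverman, *AEC*, X.§4. [folklore] -/
theorem localRestriction_eq_ofEmb :
    W.localRestriction E = W.localRestrictionOfEmb (closureEmb (K := K) E) :=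
  rfl

/-- The local restriction `H¹(K, E) → H¹(E, E)` as an additive group homomorphism.
Silverman, *AEC*, X.§4. [folklore] -/
def localRestrictionHom : W.galH1 →+ W.localH1 E :=
  (localRestriction W E).hom.toLinearMap.toAddMonoidHom

/-- The kernel of the local restriction `H¹(K, E) → H¹(E, E)` for the chosen embedding: the classes
that become trivial over `E`. Silverman, *AEC*, X.§4. [folklore] -/
def localRestrictionKer : AddSubgroup W.galH1 :=
  resKer (resGal (K := K) E) (pointsMap W E) (pointsMap_smul W E)

/-- `localRestrictionKer` is the kernel of `localRestrictionHom` (definitional).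
Silverman, *AEC*, X.§4. [folklore] -/
theorem localRestrictionKer_eq_ker : W.localRestrictionKer E = (W.localRestrictionHom E).ker :=
  rfl

/-- Membership in the local kernel. Silverman, *AEC*, X.§4. [folklore] -/
theorem mem_localRestrictionKer_iff (c : W.galH1) :
    c ∈ W.localRestrictionKer E ↔ W.localRestrictionHom E c = 0 :=
  Iff.rfl

/-- `localRestrictionKer W E` is `localRestrictionKerOfEmb W (closureEmb E)` (definitional).
Silverman, *AEC*, X.§4. [folklore] -/
theorem localRestrictionKer_eq_ofEmb :
    W.localRestrictionKer E = W.localRestrictionKerOfEmb (closureEmb (K := K) E) :=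
  rfl

/-- Independence of the embedding: the kernel of `H¹(K, E) → H¹(E, E)` does not depend on the choice
of the `K`-embedding `K̄ → K̄_E` (two embeddings differ by `τ ∈ Γ_K`, and conjugation by `τ` acts
trivially on `H¹(Γ_K, E(K̄))`). Serre, *Galois Cohomology*, I.§2.4 (Prop. 3) and II.§1.1;
Silverman, *AEC*, X.§4 (Remark 4.1.1). [cite: SerreGaloisCohomology1997, I.§2.4 Prop. 3 and II.§1.1] [cite: SilvermanAEC2009, X.§4 Remark 4.1.1] -/
def localRestrictionKerOfEmb_eq : Prop :=
  ∀ (ι : AlgebraicClosure K →ₐ[K] AlgebraicClosure E),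
    W.localRestrictionKerOfEmb ι = W.localRestrictionKer E

section NumberField

variable [NumberField K]

/-- The **Tate–Shafarevich group** `Ш(E/K) ⊆ H¹(K, E)` of `W` over the number field `K`: the classes
whose restriction to `H¹(K_v, E)` vanishes for every finite place `v` (`K_v = v.adicCompletion K`)
and every infinite place `w` (`K_w = w.Completion`).
Tate (1974), §1; Silverman, *AEC*, X.§4; Milne, *ADT*, I.§6. [cite: Tate1974] -/
def sha : AddSubgroup W.galH1 :=
  (⨅ v : HeightOneSpectrum (𝓞 K), W.localRestrictionKer (v.adicCompletion K)) ⊓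
    ⨅ w : InfinitePlace K, W.localRestrictionKer w.Completion

/-- Membership in `Ш(E/K)`: a class lies in `Ш` iff it dies in `H¹(K_v, E)` for all finite `v` and in
`H¹(K_w, E)` for all infinite `w`. Silverman, *AEC*, X.§4. [folklore] -/
theorem mem_sha_iff (c : W.galH1) :
    c ∈ W.sha ↔ (∀ v : HeightOneSpectrum (𝓞 K), c ∈ W.localRestrictionKer (v.adicCompletion K)) ∧
      ∀ w : InfinitePlace K, c ∈ W.localRestrictionKer w.Completion := by
  simp only [sha, AddSubgroup.mem_inf, AddSubgroup.mem_iInf]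

/-- `Ш(E/K)` does not depend on the choices of embeddings `K̄ → K̄_v`: replacing them by arbitrary
`K`-embeddings `ι v`, `ι' w` gives the same subgroup of `H¹(K, E)`.
Serre, *Galois Cohomology*, II.§1.1; Silverman, *AEC*, X.§4 (Remark 4.1.1). [folklore] -/
def sha_eq_of_algHom : Prop :=
  ∀ (ι : ∀ v : HeightOneSpectrum (𝓞 K), AlgebraicClosure K →ₐ[K] AlgebraicClosure (v.adicCompletion K)) (ι' : ∀ w : InfinitePlace K, AlgebraicClosure K →ₐ[K] AlgebraicClosure w.Completion),
    W.sha = (⨅ v : HeightOneSpectrum (𝓞 K), W.localRestrictionKerOfEmb (ι v)) ⊓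
      ⨅ w : InfinitePlace K, W.localRestrictionKerOfEmb (ι' w)

/- interim proof relied on results that are now named facts (D-0014); demoted to a fact by the M5 import, proof preserved:
:= by
  simp only [sha, localRestrictionKerOfEmb_eq]
-/

/-- The order `#Ш(E/K)` as a natural number (`Nat.card`; junk value `0` if `Ш` is infinite, which
conjecturally never happens). Tate (1974), §1; Silverman, *AEC*, X.§4 and C.§16 (BSD formula). [cite: Tate1974] -/
def shaOrder : ℕ :=
  Nat.card W.sha

end NumberField

/-- OPEN CONJECTURE — **finiteness of the Tate–Shafarevich group**, posed as Silverman, *AEC*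
(2nd ed.), Conjecture X.4.13 (§X.4, `K` a number field; immediately before Cassels' Thm. X.4.14):
"Let `E/K` be an elliptic curve. Then `Ш(E/K)` is finite."; see also Tate (1974), §1.
[status: open]: `Finite W.sha`, "`Ш(E/K)` is finite", for the Weierstrass curve `W` over the
number field `K`. A per-curve **predicate**, not a vendored result: users take `(h : W.ShaFinite)`
as a hypothesis (`shaOrder_pos`; the BSD leading-term files) or prove it in known cases; the
conjecture asserts it for every elliptic curve over every number field
(`Literature.NumberTheory.EllipticCurves.ShaFiniteConjectureNF`, `…ShaFiniteConjecture` over `ℚ`,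
file `BSDSha`), so no `ShaFinite_holds` can exist short of settling it — a registered open
statement, not literature debt (own header binders, elaborated type unchanged: see the
module docstring).
Status: open in general; "proven for certain elliptic curves by Kolyvagin [130] and Rubin [215]"
(loc. cit.; C.16.5.5): `E/ℚ` of analytic rank `≤ 1` (Gross–Zagier, Kolyvagin; cf. the Heegner-point
form `mordellWeilRank_eq_one_of_analyticRankEK_eq_one`, file `BSDHeegnerPoints`), CM curves with
`L(E, 1) ≠ 0` (Rubin 1987, Thm. A; the tree fact `Rubin1987_shaFinite_baseChange_cmField`, file
`ComplexMultiplicationShaProofs`). `Ш(E/K)[n]`, `n ≠ 0`, is finite (`finite_sha_torsionBy`,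
Thm. X.4.2(b), proved in `ShaFiniteProofs`). [cite: SilvermanAEC2009, Conj. X.4.13] -/
def ShaFinite (W : WeierstrassCurve K) [NumberField K] : Prop :=
  Finite W.sha

section NumberField

variable [NumberField K]

/-- If `Ш` is finite then `shaOrder` is positive (no junk value). Silverman, *AEC*, X.§4. [folklore] -/
theorem shaOrder_pos (h : W.ShaFinite) : 0 < W.shaOrder := by
  unfold shaOrder ShaFinite at *
  exact Nat.card_pos

/-- For an elliptic curve over a number field and `n ≠ 0`, the `n`-torsion `Ш(E/K)[n]` is finite
(it is a quotient of the finite `n`-Selmer group; weak Mordell–Weil).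
Silverman, *AEC*, X.4.2(b) and X.§4; Milne, *ADT*, I.6.6. [cite: SilvermanAEC2009, Thm. X.4.2(b)] -/
def finite_sha_torsionBy : Prop :=
  ∀ [W.IsElliptic] (n : ℤ) (hn : n ≠ 0),
    Finite (AddSubgroup.torsionBy W.sha n)

end NumberField

end WeierstrassCurve

/-! ## Injectivity of `Γ_{K_v} → Γ_K` -/

namespace Literature.NumberTheory.EllipticCurves

variable {K : Type u} [Field K] [NumberField K]

/-- For a finite place `v`, the restriction `Γ_{K_v} → Γ_K` is injective, identifying `Γ_{K_v}`
with a decomposition group at `v` (Krasner's lemma: `K̄ · K_v` is dense in, indeed equal to, `K̄_v`).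
Serre, *Local Fields*, II.§3, and *Galois Cohomology*, II.§6.1; Silverman, *AEC*, X.§4. [cite: SerreGaloisCohomology1997, II.§6.1] [cite: SerreLocalFields1979, II.§3] -/
def resGalAux_injective : Prop :=
  ∀ (v : HeightOneSpectrum (𝓞 K)),
    Function.Injective (resGalAux (K := K) (v.adicCompletion K))

/-- For an infinite place `w`, the restriction `Γ_{K_w} → Γ_K` is injective (`Γ_{K_w}` has order
`≤ 2`, generated by a complex conjugation). Serre, *Galois Cohomology*, II.§6.1;
Silverman, *AEC*, X.§4. [cite: SerreGaloisCohomology1997, II.§6.1] -/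
def resGalAux_injective_infinitePlace : Prop :=
  ∀ (w : InfinitePlace K),
    Function.Injective (resGalAux (K := K) w.Completion)

end Literature.NumberTheory.EllipticCurves

/-! ## Inner automorphisms act trivially on `H¹` (Mathlib continuous cohomology, discrete coefficients)

Generic glue used to discharge `WeierstrassCurve.localRestrictionKerOfEmb_eq`: for a topological group `G`,
a topological representation `X : TopRep k G` with *discrete* carrier and `τ : G`, the endomorphism of
`H¹_cont(G, X)` induced by the compatible pair `(g ↦ τ⁻¹ g τ, m ↦ τ • m)` is the identity
(Serre, *Corps locaux*, VII.§5, Prop. 3; used in *Cohomologie galoisienne*, II.§1.1). The proof is the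
explicit degree-one homotopy in homogeneous cochains: for a `1`-cocycle `F`, the image is
`(x, y) ↦ F (xτ) (yτ)`, and `F (xτ) (yτ) - F x y = h y - h x` with `h x = F x (xτ)`; continuity of `h`
uses discreteness of `X` (no local compactness of `G` is needed).
-/

namespace Literature.NumberTheory.EllipticCurves

section InnerAut

open CategoryTheory ContRepresentation TopRep Filter Topology

variable {k : Type*} [Ring k] [TopologicalSpace k]
variable {G : Type*} [Group G] [TopologicalSpace G] [IsTopologicalGroup G]

/-- Conjugation `g ↦ τ⁻¹ g τ` by a fixed `τ ∈ G`, as a continuous monoid homomorphism `G →ₜ* G`.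
Serre, *Galois Cohomology*, I.§2.4. [folklore] -/
def conjCMH (τ : G) : G →ₜ* G where
  toFun g := τ⁻¹ * g * τ
  map_one' := by simp
  map_mul' a b := by simp [mul_assoc]
  continuous_toFun := by fun_prop

/-- Unfolding `conjCMH`. [folklore] -/
@[simp] lemma conjCMH_apply (τ g : G) : conjCMH τ g = τ⁻¹ * g * τ := rfl

variable (X : TopRep k G)

/-- The action of `τ` on `X` as a morphism `res (conjCMH τ) X ⟶ X` of topological `G`-representations,
i.e. `(conjCMH τ, X.ρ τ)` is a compatible pair. Serre, *Galois Cohomology*, I.§2.4. [folklore] -/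
def actHom (τ : G) : res (conjCMH τ : G →* G) X ⟶ X :=
  ofHom
    { toContinuousLinearMap := X.ρ τ
      isIntertwining' := fun g ↦ by
        ext m
        change X.ρ τ (X.ρ (τ⁻¹ * g * τ) m) = X.ρ g (X.ρ τ m)
        have e : τ * (τ⁻¹ * g * τ) = g * τ := by group
        have e1 : X.ρ τ (X.ρ (τ⁻¹ * g * τ) m) = X.ρ (τ * (τ⁻¹ * g * τ)) m := by
          rw [map_mul X.ρ τ (τ⁻¹ * g * τ)]; rfl
        have e2 : X.ρ g (X.ρ τ m) = X.ρ (g * τ) m := by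
          rw [map_mul X.ρ g τ]; rfl
        rw [e1, e2, e] }

/-- Unfolding `actHom`. [folklore] -/
@[simp] lemma actHom_hom_apply (τ : G) (m : X) : (actHom X τ).hom m = X.ρ τ m := rfl

-- As in Mathlib's `ContCohomology` files: needed to see the terms of `homogeneousCochains X` as
-- invariant submodules (elementwise computations below).
set_option allowUnsafeReducibility true in
attribute [local reducible] CategoryTheory.Functor.mapHomologicalComplex

/-- The inclusion of cocycles into homogeneous cochains is injective (it is a monomorphism of
topological modules, and the forgetful functor to modules is a right adjoint). [folklore] -/
lemma iCycles_injective (n : ℕ) :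
    Function.Injective ((homogeneousCochains X).iCycles n).hom := by
  have : Mono ((forget₂ (TopModuleCat k) (ModuleCat k)).map ((homogeneousCochains X).iCycles n)) :=
    inferInstance
  exact (ModuleCat.mono_iff_injective _).mp this

/-- The differential `C(G, X) → C(G, C(G, X))` of Mathlib's resolution: `(d f) x y = f y - f x`.
Serre, *Galois Cohomology*, I.§2.2. [folklore] -/
lemma d_one_apply (f : C(G, X)) (x y : G) : (d X 1).hom f x y = f y - f x := rfl

/-- The differential in the next degree: `(d F) x y z = F y z - F x z + F x y`.
Serre, *Galois Cohomology*, I.§2.2. [folklore] -/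
lemma d_two_apply (F : C(G, C(G, X))) (x y z : G) :
    (d X 2).hom F x y z = F y z - (F x z - F x y) := rfl

/-- The cochain map of the inner pair `(conjCMH τ, X.ρ τ)` on `1`-cochains:
`F ↦ ((x, y) ↦ τ • F (τ⁻¹xτ) (τ⁻¹yτ))`. Serre, *Galois Cohomology*, I.§2.4. [folklore] -/
lemma cochainsMap_conj_f_one_apply (τ : G) (F : (homogeneousCochains X).X 1) (x y : G) :
    (((ContinuousCohomology.cochainsMap (conjCMH τ) (actHom X τ)).f 1).hom F).1 x y =
      X.ρ τ (F.1 (τ⁻¹ * x * τ) (τ⁻¹ * y * τ)) := rfl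

/-- Homogeneity of a `1`-cochain: `g • F (g⁻¹x) (g⁻¹y) = F x y`.
Serre, *Galois Cohomology*, I.§2.2. [folklore] -/
lemma coe_invariants_two_apply (F : (homogeneousCochains X).X 1) (g x y : G) :
    X.ρ g (F.1 (g⁻¹ * x) (g⁻¹ * y)) = F.1 x y :=
  DFunLike.congr_fun (DFunLike.congr_fun (F.2 g) x) y

variable [DiscreteTopology X]

/-- For a homogeneous `F : C(G, C(G, X))` with `X` discrete, the diagonal-type map `x ↦ F x (xτ)` is
continuous (locally constant): near `x₀`, `F (gx₀) (gx₀τ) = (gx₀) • F 1 τ = F (gx₀) (x₀τ) = F x₀ (x₀τ)`.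
[folklore] -/
lemma continuous_homotopyFun (F : C(G, C(G, X)))
    (hF : ∀ g x y, X.ρ g (F (g⁻¹ * x) (g⁻¹ * y)) = F x y) (τ : G) :
    Continuous fun x ↦ F x (x * τ) := by
  have key : ∀ x y, F x y = X.ρ x (F 1 (x⁻¹ * y)) := fun x y ↦ by
    rw [← hF x x y, inv_mul_cancel]
  refine continuous_iff_continuousAt.mpr fun x₀ ↦ ?_
  rw [ContinuousAt, nhds_discrete X, tendsto_pure, ← map_mul_right_nhds_one x₀, eventually_map]
  have h1 : ∀ᶠ g : G in 𝓝 1, F (g * x₀) (x₀ * τ) = F x₀ (x₀ * τ) := by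
    have hc : Continuous fun g : G ↦ F (g * x₀) (x₀ * τ) :=
      (continuous_eval_const (x₀ * τ)).comp
        (F.continuous.comp (continuous_mul_const x₀))
    have := hc.continuousAt (x := 1)
    rw [ContinuousAt, nhds_discrete X, tendsto_pure] at this
    simpa using this
  have h2 : ∀ᶠ g : G in 𝓝 1, F 1 ((g * x₀)⁻¹ * (x₀ * τ)) = F 1 τ := by
    have hc : Continuous fun g : G ↦ F 1 ((g * x₀)⁻¹ * (x₀ * τ)) :=
      (F 1).continuous.comp (by fun_prop)
    have := hc.continuousAt (x := 1)
    rw [ContinuousAt, nhds_discrete X, tendsto_pure] at this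
    simpa using this
  filter_upwards [h1, h2] with g hg1 hg2
  rw [key (g * x₀) (g * x₀ * τ), inv_mul_cancel_left, ← hg2, ← key, hg1]

/-- The homogeneous `0`-cochain `h : x ↦ F x (xτ)` attached to a `1`-cochain `F` and `τ ∈ G`
(the degree-one homotopy for the inner pair). Serre, *Corps locaux*, VII.§5, Prop. 3. [folklore] -/
def homotopyCochain (τ : G) (F : (homogeneousCochains X).X 1) : (homogeneousCochains X).X 0 :=
  ⟨⟨fun x ↦ F.1 x (x * τ), continuous_homotopyFun X F.1 (coe_invariants_two_apply X F) τ⟩, fun g ↦ by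
    ext x
    change X.ρ g (F.1 (g⁻¹ * x) (g⁻¹ * x * τ)) = F.1 x (x * τ)
    rw [mul_assoc]
    exact coe_invariants_two_apply X F g x (x * τ)⟩

/-- For a `1`-cocycle `F`, the image of `F` under the inner pair `(conjCMH τ, X.ρ τ)` is
`F + d (homotopyCochain τ F)`. Serre, *Corps locaux*, VII.§5, Prop. 3. [folklore] -/
lemma cochainsMap_conj_f_one_eq (τ : G) (F : (homogeneousCochains X).X 1)
    (hF : ((homogeneousCochains X).d 1 2).hom F = 0) :
    ((ContinuousCohomology.cochainsMap (conjCMH τ) (actHom X τ)).f 1).hom F =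
      F + ((homogeneousCochains X).d 0 1).hom (homotopyCochain X τ F) := by
  have hd : ∀ x y z, F.1 y z - (F.1 x z - F.1 x y) = 0 := fun x y z ↦ by
    have := congr($(hF).1 x y z)
    rw [homogeneousCochains.d_apply] at this
    exact this
  apply Subtype.ext
  rw [Submodule.coe_add, homogeneousCochains.d_apply]
  ext x y
  rw [cochainsMap_conj_f_one_apply, ContinuousMap.add_apply, ContinuousMap.add_apply, d_one_apply]
  change _ = F.1 x y + (F.1 y (y * τ) - F.1 x (x * τ))
  have e1 : X.ρ τ (F.1 (τ⁻¹ * x * τ) (τ⁻¹ * y * τ)) = F.1 (x * τ) (y * τ) := by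
    simpa only [mul_assoc] using coe_invariants_two_apply X F τ (x * τ) (y * τ)
  rw [e1]
  have h1 := hd x (x * τ) (y * τ)
  have h2 := hd x y (y * τ)
  have key : (F.1 (x * τ) (y * τ) - (F.1 x (y * τ) - F.1 x (x * τ))) -
      (F.1 y (y * τ) - (F.1 x (y * τ) - F.1 x y)) = 0 := by rw [h1, h2, sub_zero]
  rw [← sub_eq_zero, ← key]
  abel

/-- **Inner automorphisms act trivially on `H¹`.** For a topological group `G`, a topological
representation `X` of `G` with discrete carrier and `τ ∈ G`, the endomorphism of `H¹_cont(G, X)`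
induced by the compatible pair `(g ↦ τ⁻¹gτ, m ↦ τ • m)` is the identity.
Serre, *Corps locaux*, VII.§5, Prop. 3; *Cohomologie galoisienne*, II.§1.1.
[cite: SerreGaloisCohomology1997, II.§1.1 (independence of the choice of `j`, via Corps locaux VII.§5 Prop. 3)] -/
theorem map_conj_one_eq_id (τ : G) :
    ContinuousCohomology.map (conjCMH τ) (actHom X τ) 1 = 𝟙 _ := by
  rw [← cancel_epi (ContinuousCohomology.π X 1), ContinuousCohomology.π_map, Category.comp_id]
  ext z
  change ((homogeneousCochains X).homologyπ 1).hom
      ((ContinuousCohomology.cocyclesMap (conjCMH τ) (actHom X τ) 1).hom z) =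
    ((homogeneousCochains X).homologyπ 1).hom z
  set C := homogeneousCochains X
  set h := homotopyCochain X τ ((C.iCycles 1).hom z)
  have hz : (ContinuousCohomology.cocyclesMap (conjCMH τ) (actHom X τ) 1).hom z =
      z + (C.toCycles 0 1).hom h := by
    apply iCycles_injective X 1
    have e1 := congr($(HomologicalComplex.cyclesMap_i
      (ContinuousCohomology.cochainsMap (conjCMH τ) (actHom X τ)) 1).hom z)
    have e2 := congr($(C.toCycles_i 0 1).hom h)
    have e3 := congr($(C.iCycles_d 1 2).hom z)
    simp only [TopModuleCat.hom_comp, ContinuousLinearMap.coe_comp, Function.comp_apply] at e1 e2 e3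
    rw [map_add, e1, e2]
    exact cochainsMap_conj_f_one_eq X τ _ e3
  rw [hz, map_add]
  have e4 := congr($(C.toCycles_comp_homologyπ 0 1).hom h)
  simp only [TopModuleCat.hom_comp, ContinuousLinearMap.coe_comp, Function.comp_apply,
    TopModuleCat.hom_zero, zero_apply] at e4
  rw [e4, add_zero]

end InnerAut

end Literature.NumberTheory.EllipticCurves

/-! ## Independence of the embedding: discharge of `localRestrictionKerOfEmb_eq` -/

namespace Literature.NumberTheory.EllipticCurves

section EmbChange

variable {K : Type u} [Field K] {E : Type u} [Field E] [Algebra K E]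

/-- Two `K`-embeddings `K̄ → K̄_E` differ by an element of `Γ_K = Aut(K̄/K)` (`K̄/K` is normal).
Serre, *Galois Cohomology*, II.§1.1. [folklore] -/
theorem exists_algHom_eq_comp (ι₀ ι : AlgebraicClosure K →ₐ[K] AlgebraicClosure E) :
    ∃ τ : AlgebraicClosure K ≃ₐ[K] AlgebraicClosure K,
      ι = ι₀.comp (τ : AlgebraicClosure K →ₐ[K] AlgebraicClosure K) := by
  letI : Algebra (AlgebraicClosure K) (AlgebraicClosure E) := ι₀.toRingHom.toAlgebra
  haveI : IsScalarTower K (AlgebraicClosure K) (AlgebraicClosure E) :=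
    IsScalarTower.of_algebraMap_eq fun x ↦ (ι₀.commutes x).symm
  refine ⟨ι.restrictNormal' (AlgebraicClosure K), AlgHom.ext fun x ↦ ?_⟩
  have h := AlgHom.restrictNormal_commutes ι (AlgebraicClosure K) x
  exact h.symm

/-- Changing the embedding by `τ ∈ Γ_K` conjugates the restriction `Γ_E → Γ_K`:
`resGalOfEmb (ι₀ ∘ τ) σ = τ⁻¹ (resGalOfEmb ι₀ σ) τ`. Serre, *Galois Cohomology*, II.§1.1. [folklore] -/
theorem resGalOfEmb_comp (ι₀ : AlgebraicClosure K →ₐ[K] AlgebraicClosure E)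
    (τ : AlgebraicClosure K ≃ₐ[K] AlgebraicClosure K) :
    resGalOfEmb (ι₀.comp (τ : AlgebraicClosure K →ₐ[K] AlgebraicClosure K)) =
      (conjCMH (show Field.absoluteGaloisGroup K from τ)).comp (resGalOfEmb ι₀) := by
  apply ContinuousMonoidHom.ext
  intro σ
  apply AlgEquiv.ext
  intro x
  apply (ι₀.comp (τ : AlgebraicClosure K →ₐ[K] AlgebraicClosure K)).toRingHom.injective
  change (ι₀.comp (τ : AlgebraicClosure K →ₐ[K] AlgebraicClosure K))
      ((show AlgebraicClosure K ≃ₐ[K] AlgebraicClosure K from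
        resGalAuxOfEmb (ι₀.comp (τ : AlgebraicClosure K →ₐ[K] AlgebraicClosure K)) σ) x) =
    ι₀ (τ (τ.symm ((show AlgebraicClosure K ≃ₐ[K] AlgebraicClosure K from resGalAuxOfEmb ι₀ σ)
      (τ x))))
  rw [apply_resGalAuxOfEmb_apply, AlgEquiv.apply_symm_apply, apply_resGalAuxOfEmb_apply,
    AlgHom.comp_apply]
  rfl

variable (W : WeierstrassCurve K)

/-- Changing the embedding by `τ ∈ Γ_K` twists the map on points: `(ι₀ ∘ τ)_* P = ι₀_* (τ • P)`.
Silverman, *AEC*, X.§4. [folklore] -/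
theorem pointsMapOfEmb_comp (ι₀ : AlgebraicClosure K →ₐ[K] AlgebraicClosure E)
    (τ : AlgebraicClosure K ≃ₐ[K] AlgebraicClosure K) :
    pointsMapOfEmb W (ι₀.comp (τ : AlgebraicClosure K →ₐ[K] AlgebraicClosure K)) =
      (pointsMapOfEmb W ι₀).comp (DistribSMul.toAddMonoidHom (WeierstrassCurve.geomPoints W)
        (show Field.absoluteGaloisGroup K from τ)) := by
  ext P
  change WeierstrassCurve.Affine.Point.map _ P =
    WeierstrassCurve.Affine.Point.map ι₀
      (WeierstrassCurve.Affine.Point.map (τ : AlgebraicClosure K →ₐ[K] AlgebraicClosure K) P)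
  rw [WeierstrassCurve.Affine.Point.map_map]

end EmbChange

section ResKerConj

open CategoryTheory ContRepresentation TopRep

variable {G : Type u} [Group G] [TopologicalSpace G] [IsTopologicalGroup G]
variable {M : Type u} [AddCommGroup M] [DistribMulAction G M] [TopologicalSpace M]
  [DiscreteTopology M]
variable {H : Type u} [Group H] [TopologicalSpace H] [IsTopologicalGroup H]
variable {N : Type u} [AddCommGroup N] [DistribMulAction H N] [TopologicalSpace N]
  [DiscreteTopology N]

/-- `resKer` only depends on the compatible pair `(φ, ψ)` (congruence in both arguments).
Serre, *Galois Cohomology*, I.§2.4. [folklore] -/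
theorem resKer_congr {φ φ' : H →ₜ* G} {ψ ψ' : M →+ N} (hφ : φ = φ') (hψ : ψ = ψ')
    (h : ∀ (x : H) (m : M), ψ (φ x • m) = x • ψ m) :
    resKer φ ψ h = resKer φ' ψ' (fun x m ↦ by subst hφ hψ; exact h x m) := by
  subst hφ hψ
  rfl

/-- Precomposing a compatible pair `(φ, ψ)` with the inner pair `(g ↦ τ⁻¹ g τ, m ↦ τ • m)` of
`τ ∈ G` does not change the kernel of `H¹(G, M) → H¹(H, N)` (inner automorphisms act trivially on
`H¹(G, M)`). Serre, *Galois Cohomology*, II.§1.1 and *Corps locaux*, VII.§5 Prop. 3. [folklore] -/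
theorem resKer_conj_comp (φ : H →ₜ* G) (ψ : M →+ N)
    (h : ∀ (x : H) (m : M), ψ (φ x • m) = x • ψ m) (τ : G)
    (h' : ∀ (x : H) (m : M), (ψ.comp (DistribSMul.toAddMonoidHom M τ)) ((conjCMH τ).comp φ x • m) =
      x • (ψ.comp (DistribSMul.toAddMonoidHom M τ)) m) :
    resKer ((conjCMH τ).comp φ) (ψ.comp (DistribSMul.toAddMonoidHom M τ)) h' = resKer φ ψ h := by
  unfold resKer
  have e : resHomOfEquivariant ((conjCMH τ).comp φ) (ψ.comp (DistribSMul.toAddMonoidHom M τ)) h' =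
      (resFunctor (φ : H →* G)).map (actHom (discreteTopRep G M) τ) ≫ resHomOfEquivariant φ ψ h := by
    apply TopRep.hom_ext
    apply ContIntertwiningMap.ext
    ext m
    rfl
  have hmap : ContinuousCohomology.map ((conjCMH τ).comp φ)
      (resHomOfEquivariant ((conjCMH τ).comp φ) (ψ.comp (DistribSMul.toAddMonoidHom M τ)) h') 1 =
      ContinuousCohomology.map φ (resHomOfEquivariant φ ψ h) 1 := by
    have hc := ContinuousCohomology.map_comp (conjCMH τ) φ (actHom (discreteTopRep G M) τ)
      (resHomOfEquivariant φ ψ h) 1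
    rw [map_conj_one_eq_id, Category.id_comp] at hc
    rw [e]
    exact hc
  rw [hmap]

end ResKerConj

end Literature.NumberTheory.EllipticCurves

namespace WeierstrassCurve

open Literature.NumberTheory.EllipticCurves

variable {K : Type u} [Field K] (W : WeierstrassCurve K) {E : Type u} [Field E] [Algebra K E]

/-- The kernel of `H¹(K, E) → H¹(E, E)` is unchanged when the embedding `ι₀` is replaced by `ι₀ ∘ τ`,
`τ ∈ Γ_K`. Serre, *Galois Cohomology*, II.§1.1. [folklore] -/
theorem localRestrictionKerOfEmb_comp (ι₀ : AlgebraicClosure K →ₐ[K] AlgebraicClosure E)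
    (τ : AlgebraicClosure K ≃ₐ[K] AlgebraicClosure K) :
    W.localRestrictionKerOfEmb (ι₀.comp (τ : AlgebraicClosure K →ₐ[K] AlgebraicClosure K)) =
      W.localRestrictionKerOfEmb ι₀ := by
  unfold localRestrictionKerOfEmb
  rw [resKer_congr (resGalOfEmb_comp ι₀ τ) (pointsMapOfEmb_comp W ι₀ τ)]
  exact resKer_conj_comp _ _ (pointsMapOfEmb_smul W ι₀) _ _

variable (E)

/-- **Discharge** of `WeierstrassCurve.localRestrictionKerOfEmb_eq`: the kernel of the local
restriction `H¹(K, E) → H¹(E, E)` does not depend on the `K`-embedding `K̄ → K̄_E`. Two embeddings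
differ by `τ ∈ Γ_K` (`Literature.NumberTheory.EllipticCurves.exists_algHom_eq_comp`), which conjugates the compatible pair; and inner
automorphisms act trivially on `H¹` (`Literature.NumberTheory.EllipticCurves.map_conj_one_eq_id`, explicit degree-1 coboundary
`x ↦ F x (xτ)` in Mathlib's homogeneous continuous cochains).
[cite: SerreGaloisCohomology1997, II.§1.1 (maps H^q(G₁, A(K'₁)) → H^q(G₂, A(K'₂)) do not depend on the choice of j; via Corps locaux VII.§5 Prop. 3)] -/
theorem localRestrictionKerOfEmb_eq_holds : W.localRestrictionKerOfEmb_eq E := by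
  intro ι
  obtain ⟨τ, rfl⟩ := exists_algHom_eq_comp (closureEmb (K := K) E) ι
  rw [localRestrictionKer_eq_ofEmb]
  exact localRestrictionKerOfEmb_comp W _ τ

end WeierstrassCurve
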